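import Summits.BirchSwinnertonDyer.Rank1Residual.Additive.DicyclicGrowthLawsThree
import HarnessLib

/-!
# T-O6-D ≡ `MazurTateGrowthDichotomyThree`: the Mazur–Tate GROWTH DICHOTOMY at an additive potentially
# supersingular `3`, selected by LOCAL IRREDUCIBILITY `LocIrr W 3` — the O6-dicyclic reducible LEVEL LAW
# (D-R, hold-out PASSED), the irreducible SIGNED POLLACK SHAPE (S1–S4), o5-r1's T9 re-keyed by `LocIrr`,
# and the joint EVIDENCE declaration (cell `b2b-bsdres`, lane CLASS-CLOSURE, seat cc-typer-5 GEN 3 =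
# O5/O6 typer of record; asks A-O56-U1 / A-O6-T2 / A-O6-T3 of o6-r1 GEN 3; content = o6-r1 GEN 3
# (`cells/o5o6/TARGETS.md` §O6 (G3-8)–(G3-11) + CONVERGED ⟦07:25Z⟧) and o5-r1 GEN 2 (T9); placement,
# dedup and Lean phrasing = class typer) — TYPED, EVIDENCE-LABELLED, NOTHING ASSERTED

HONEST FRAMING (cell `b2b-bsdres`, verbatim in every file): the goal of the cell is to DELETE the
COMBINATION-SHAPED residual classes of the Birch–Swinnerton-Dyer formula for ALL analytic-rank `≤ 1`
elliptic curves over `ℚ` — "full BSD formula for every rank `≤ 1` curve in class `C`" assembled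
STRICTLY from published theorems — so that the rank-`≤ 1` remainder becomes exactly the
CONSTRUCTION-SHAPED classes, which are TYPED (missing-input `Prop`s), NOT attempted. This is not
"finishing BSD". Lane CLASS-CLOSURE: census output is EVIDENCE / conjecture items with held-out
validation, never a Literature fact; no main conjecture inside any certificate; nothing is booked; no
mark of `RESIDUAL-MAP.md` moves. 0 named Literature facts here; every law below is an `@[conjecture]`
EVIDENCE item (statement discovery E1 with pre-registration and hold-out, o6-r1 GEN 3 / o5-r1 GEN 2),
typed over the INTERFACES of `O6/TowerInterfaces.lean` (`TowerValuation` = D-O6-ν, `IsogenyLevelDatum`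
= D-O6-prof; their construction shapes are separate) and the tree's Mazur–Tate element
(`mazurTateElement f 3 k`, Pollack 2003 Def. 6.15; `O5.IsScaledMazurTateLift`, `lam` of
`X1/MuLambdaAlgebra.lean`). No refuted statement is typed: v1/v2 of the cyclic law and D-I* "λ′ ≡ 0"
(KILLED on its hold-out, (G3-9)) are absent; the cyclic v3′ shell waits for band C1′ (A-O6-T3 (d)).

## The picture (o6-r1 GEN 3 (G3-10)/(G3-11), o5-r1 GEN 2 T9; Doyon–Lei 2021 §6's open question)

For `W/ℚ` additive at `3` with potentially supersingular reduction — tame O5b (`e = 4`, Kodaira III /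
III*, `f₃ = 2`) or wild dicyclic O6 (`f₃ ∈ {3, 5}`, `v₃(Δ_min)` odd) — write `θ_k = ω_{k−1}·u_k`
(`Additive.OmegaDvdMazurTateOfAddv`, Doyon–Lei Lemma 5.2 / Cor. 5.3: `λ(θ_k) = 3^{k−1} + λ(u_k)`) and
`ν_k = ½ + μ(u_k) + λ(u_k)/φ(3^k)` = the `3`-adic valuation of `τ(ψ)L(W,ψ̄,1)/Ω⁺_W` at even primitive
`ψ` of conductor `3^{k+1}` (`TowerValuation.nu`). CENSUS FINDING (EVIDENCE): the growth of `λ(θ_k(W))`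
follows the SIGNED Kurihara–Pollack template (`λ(θ_k) = b_k + λ′^{(k mod 2)}`, `μ = 0`, `b_k` built from
Kurihara's `q_n` — verbatim the shape of Pollack 2003 Prop. 6.9–6.10 for GOOD supersingular `a_p = 0`)
iff `W[3]|G_{ℚ₃}` is IRREDUCIBLE (`LocIrr W 3`), and an UNSIGNED level law (`ν_k = L + ε/φ(3^k)`,
`ε ∈ ℤ` constant, `L` a Néron-defect level with the isogeny-class MAX rule — the `p = 3` twin of the
SHAPE of Lei–Pollack–Pratap arXiv:2412.16629 Thm 2 = Thm 4.7 for potentially good ORDINARY `p ≥ 5`: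
`λ(θ_n) = (p−1)v_p(Δ_E)/12·p^{n−1} + λ(Sel^∨)` under BSD(k_n)) iff it is REDUCIBLE — tame and wild
alike; supports: O5b 31 044 X4 rows (o5-r1 T9 pilot 194/194 + held-out; selector identity
`Additive.SelectorIdentityTameThree` 36 323/0), O6 dicyclic D1 108 + D1H hold-out 188 rows (D-R
151/151, dichotomy 179 | 9, 0 crossings), 2 724 O6-FW rows × `k = 2,3` on an independent engine
(cc-eng-3 ENG-D, two engines agree 8/8 where they overlap); the selector's valuation criterion
`Additive.LocIrrCriterionThree` (`2·v₃(c₆) ≥ 3·v₃(c₄) + 2`, theorem-candidate L-O56-sel) agrees with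
`polrootspadic(ψ₃)` on 188 491 further curves of every reduction type at `3` (this seat, kit j125222,
`class-closure/O6/census-typer5/locirr3-criterion/`, stdout sha16 fd1cf3f2d0116501: 0 exceptions;
o6-r1's `>` form differs exactly on the cyclic cells `2v₃(c₆) = 3v₃(c₄)+1`). Doyon–Lei §6 ("for some isogeny classes
… two formulas depending on the parity of m … CURIOUSLY there are curves with potentially supersingular
reduction whose Mazur–Tate elements do not exhibit such patterns. We will look for a theoretic
explanation on how these two distinct cases arise") — the dichotomy below OFFERS that explanation as an
EVIDENCE conjecture: signed ⟺ `W[p]|G_{ℚ_p}` irreducible; on the literature's own sample (o6-r1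
(G3-12), kit j125176: every potentially supersingular isogeny class with `9 ∣ N ≤ 700`, `θ_k` to
`k = 6`) UNSIGNED ⟺ `¬LocIrr` 139/139 and SIGNED ⟺ `LocIrr` 45/45 (184/184, tame and wild alike;
153a1/153c1/153d1 `LocIrr`, 153b1 potentially multiplicative; all 17 CM `j = 0` classes unsigned).

## Nearest prior art — the POLLACK–WESTON DICHOTOMY (o6-r1 (G3-12a); honest novelty grade: VARIANT /
## NEW-COMBINATION, not a new mechanism)

Pollack–Weston, Duke 156 (2011), THEOREM 1 (= Cor. 5.3) [galaxy:pdf:-6535538855114364040 p0002–p0003,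
p0021], verbatim core: for `p ∤ N` and `f ∈ S_k(Γ₀(N))` `p`-non-ordinary with (i) `ρ̄_f` irreducible
of Serre weight `2`, (ii) `2 < k < p² + 1`, (iii) `ρ̄_f|G_{ℚ_p}` not decomposable, "there exists an
eigenform `g ∈ S₂(Γ)` with `a_ℓ(f) ≡ a_ℓ(g) (mod p)` for all primes `ℓ ≠ p` such that if
`ρ̄_f|G_{ℚ_p}` is reducible (resp. irreducible), then (1) `μ(θ_n(f)) = 0` for `n ≫ 0` ⟺ `μ(g) = 0`
(resp. `μ^±(g) = 0`); (2) if the equivalent conditions of (1) hold, then `λ(θ_n(f)) = pⁿ − pⁿ⁻¹ +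
λ(g)` if `ρ̄_f|G_{ℚ_p}` is reducible, `= pⁿ − pⁿ⁻¹ + q_{n−1} + λ^{−ε_n}(g)` if irreducible, for
`n ≫ 0`" (`g` ordinary ⟺ reducible, their §4.5). DICTIONARY: PW's selector `ρ̄_f|G_{ℚ_p}` = our
`LocIrr W 3` (the same object); reducible ↦ UNSIGNED `L·φ(pⁿ) + ε` with `L = 1`, irreducible ↦ SIGNED
`q`-shape (PW's `q_{n−1}` = our `q_n` index shift) — so T-O6-D is the POLLACK–WESTON SHAPE at ADDITIVE
level. NOT in print (asserted here only as EVIDENCE): level divisible by `p²` (additive `p = 3`, outside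
every hypothesis of PW Thms 1–2; PW p. 3: the nebentypus weight-2 case "we did not pursue"), the slopes
`L ≠ 1` tabled by `(f₃, v₃Δ)` with the isogeny MAX rule, and the wild signed shape; Lei–Pollack–Pratap
§4.3 call the unsigned additive growth of their Ex. 4.8 unexplained "by the currently known plus and
minus Iwasawa theory" — T-O6-D says: organise additive primes by `ρ̄|G_{ℚ_p}` as PW do at good primes
(o6-r1's PREDICTION, recorded before anyone computes it: 4232i1 has `W[23]|G_{ℚ₂₃}` reducible).
Suggested proof route (O6-GEN3 §6, for provers, not a claim): Serre weight of `ρ̄_W|G_{ℚ₃}` →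
congruent weight-2 form of level prime to `3` (Ash–Stevens; PW Thm 5.1 / LPP Thm 4.9) → a SCALED
congruence of Mazur–Tate elements producing the slope `L` (the open crux: `ω_{n−1} ∣ θ_n(W)` forbids a
term-by-term congruence) → PW Thm 4.1 recursion on the irreducible branch.

## Contents (the wild clauses and the arithmetic — `dicyclicLevel`, `dicyclicEffectiveLevel`,
## `signedBase`, `nuOfLam`, `lamM`, D-R `DicyclicLevelLawThree`, S1–S4 `SignedPollackShapeThree` — live in
## the sibling `Additive/DicyclicGrowthLawsThree.lean`, split off for the 400-line rule)
* §4 o5-r1's T9 re-keyed by `LocIrr W 3` (`O5.GrowthDichotomyLawLocIrrThree`; T9 itself UNTOUCHED) with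
  the PROVED bridge from T9 + `SelectorIdentityTameThree` on `j ≠ 1728`, and the TEMPLATE IDENTITY
  `O5.signedTemplate_eq_signedBase` (III*-near base = `signedBase 9`, III-near base = `signedBase 3`).
* §5 the joint EVIDENCE declaration `MazurTateGrowthDichotomyThree real realLevel` (T-O6-D; o6-r1's
  cross-cell proposal to o5-r1 — a CONJUNCTION of the typed clauses, asserting nothing new) with its
  three projections.

EVIDENCE of record (shas sha256[:16]): `HOME/b2b-bsdres-o6-r1/gen3/tower/d1_fit_score.txt`
f1fe1832df72ed97 (D1 fit, kit j124364; deep D2 j124467), `d1h_score.txt` 8313c50ab7d3a34b (D1H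
hold-out, kit j124547 + j124549; frozen scorer `score_d1.py` 31e96a275ba63638; PRE-REGISTRATION 5 =
`run/shared/lean/ttrl/requests.jsonl` l.1516, 5a = l.1534), `engd_theta_out.tsv` f40136cebf7f7bdb
(cc-eng-3 ENG-D tables 6a5d4df1f992bfb8, 2 724 O6-FW rows); o5-r1 `HOME/b2b-bsdres-o5-r1/gen2/
LAYER-LAWS.md` §6 (T9); team file `HOME/cells/o5o6/TARGETS.md` §O6 (G3-8)–(G3-11), CONVERGED ⟦o6-r1 g3
07:25Z⟧. References: [MazurTate1987] Duke 54 §1; [Pollack2003] Duke 118 Def. 6.15, Prop. 6.9–6.10;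
[Kurihara2002] Invent. 149 Thm 0.1 (`q_n`, unit criterion); [DoyonLei2021] arXiv:2103.06154 Lemma 5.2,
Cor. 5.3, §6 [corpus: paper-arxiv-2103.06154 p0009–p0010]; [LeiPollackPratap2024] arXiv:2412.16629 Thm 2
= Thm 4.7 (p. 13), §4.3, Ex. 4.8, Conj. 4.11 [corpus: paper-arxiv-2412.16629 p0004, p0013–p0015];
[PollackWeston2011MT] Duke 156 Thm 1 = Cor. 5.3 [galaxy:pdf:-6535538855114364040 p0002–p0003, p0021];
[FouquetWan2021] arXiv:2107.13726 Thm 5.1 (the (Lgl) bit); theory note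
`HOME/b2b-bsdres-o6-r1/gen3/O6-GEN3.md` §§1–7 (v3).

## NOTE (o6-r1 GEN 7, ask A-O6-T8; recorded by cc-typer-5 GEN 4, 2026-08-21 — DOC-ONLY, no declaration or
## statement changed): THE LEADING COEFFICIENT IS DERIVED
The leading term `(if v₃Δ_min = 9 then 2 else 1)·3^{n−1}` of `O5.GrowthDichotomyLawLocIrrThree` (node of
record, §4) and of `signedBase` (S1–S4 `SignedPollackShapeThree`, sibling `DicyclicGrowthLawsThree`) is no longer a
free census fit: o6-r1 GEN 7 derives it from (a) `ω_{n−1} ∣ θ_n` for EVERY additive curve at `3`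
(`Additive.OmegaDvdMazurTateOfAddv`, p253482; `p = 3` carrier `OmegaDvdMazurTateAdditiveThree`), (b) the EXACT twist
identity E-TW `θ_n^±(W) = κ'^± σ(1−g)·tw_ω θ_n^∓(W₀)` between a `v₃Δ_min = 9` curve and its `(−3)`-twist `W₀` of the
SAME conductor with `v₃Δ_min(W₀) = 3` (820/820 pairs, 0 failures; `κ'` a `3`-adic UNIT by Pal 2012 Thm 3.2 +
Connell), (c) the signature dichotomy on `27 ∥ N` (T7). Typed consequences: `Additive.OmegaSqDvdMazurTateNineThree`
(`θ_n ∈ (1−g)²ℤ₍₃₎[G_n]` on the `v₃Δ_min = 9` sector) and `Additive.LambdaLowerBoundNineThree` /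
`LambdaLowerBoundAdditiveThree` (`λ ≥ 2·3^{n−1}` resp. `≥ 3^{n−1}`), all in `Additive/MazurTateDivisibilityThree.lean`
(cc-typer-5 p270064). The remainder `q_{n−1} + c` of the template stays EVIDENCE. Records: o6-r1
`gen7/O6-GEN7.md` §2–§3b, `cells/o5o6/TARGETS.md` §O6 (G7-1)…(G7-8), `class-closure/O6/TYPED.md` §8.
-/

set_option autoImplicit false

noncomputable section

open scoped Classical MatrixGroups ModularForm NumberField

open CongruenceSubgroup Polynomial WeierstrassCurve NumberField Literature.NumberTheory.EllipticCurves
  Literature.NumberTheory.EllipticCurves.ModularForms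
  Literature.NumberTheory.EllipticCurves.Rank1Residual
  Literature.NumberTheory.EllipticCurves.Rank1Residual.Typed
  Summit.BirchSwinnertonDyer.Rank1Residual.X1.MuLambda

/-! ## §4 o5-r1's T9 re-keyed by `LocIrr W 3` (T9 itself untouched) and the proved bridge -/

namespace Summit.BirchSwinnertonDyer.Rank1Residual.O5

open Summit.BirchSwinnertonDyer.Rank1Residual.Additive

/-- **NODE OF RECORD for the O5b growth dichotomy (o5-r1 GEN 3 consent, 2026-08-21T10:27Z: T9 re-keyed
by `LocIrr W 3`; the j-form `O5.GrowthDichotomyLawThree` is retired to the corollary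
`growthDichotomyLawThree_of_ne_1728` below). T9 with the selector `LocIrr W 3` (A-O56-U1; CONJECTURE;
EVIDENCE-labelled; o5-r1's T9 content, o6-r1's selector).** VERBATIM `O5.GrowthDichotomyLawThree` with `s(W) := [W[3]|G_{ℚ₃} irreducible]`
(`Additive.LocIrr W 3`) in place of `[v₃(j − 1728) ≥ 7]`: for non-`j = 0` `W ∈ O5b` with `ρ̄_{W,3}`
irreducible, eventually `λ(θ_n(W)) = b(W)·3^{n−1} + s(W)·q_{n−1} + c_{n mod 2}(W)` with `c₀ = c₁` when
`s = 0`. On the census the two selectors are THE SAME BIT (o6-r1 GEN 3 (G3-10), kit j124555: near =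
LocIrr = 11 310, generic = reducible = 25 013 of 36 323 III/III* rows, 0 exceptions — typed as the target
`Additive.SelectorIdentityTameThree`), so this is T9's content; the gain is conceptual and at `j = 1728`
(`c₆ = 0`: `LocIrr` holds — the CM-`ℤ[i]` curves are put on the SIGNED side, as LLP Conj. 4.11 wants —
whereas `v₃(j − 1728)` is junk `0` there). Bridge: `growthDichotomy_locIrr_of_growthDichotomyLaw` (T9 +
selector identity ⇒ this law's conclusion on `j ≠ 1728`). EVIDENCE = T9's (194/194 pilot row-branches,
`LAYER-LAWS.md` §6) read through the selector identity. [cite: DoyonLei2021, §6]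
[cite: LeiPollackPratap2024, Thm 4.5, §4.3 and Conj. 4.11] [cite: FouquetWan2021, Thm. 5.1 (the (Lgl) bit)] -/
@[conjecture] def GrowthDichotomyLawLocIrrThree : Prop :=
  ∀ (W : WeierstrassCurve ℚ) [W.IsElliptic] [W.IsGloballyMinimal] [NeZero (W.conductorNorm ℤ)]
    (f : CuspForm (Gamma0 (W.conductorNorm ℤ)) 2), IsNewformOf W f → ClassO5 W 3 → SubTprime W 3 →
    W.HasIrreducibleModPGaloisRep 3 → W.j ≠ 0 →
    ∃ n₀ c₀ c₁ : ℕ, (¬ LocIrr W 3 → c₀ = c₁) ∧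
      ∀ (n k : ℕ) (Θ : IwasawaAlgebra 3), n₀ ≤ n → IsScaledMazurTateLift f n k Θ → Θ ≠ 0 →
        lam Θ = (if padicValRat 3 W.Δ = 9 then 2 else 1) * 3 ^ (n - 1) +
          (if LocIrr W 3 then kuriharaQ (n - 1) else 0) +
          (if n % 2 = 0 then c₀ else c₁)

/-- **BRIDGE (proved): T9 + the selector identity ⇒ the `LocIrr` form on `j ≠ 1728`.** Nothing beyond
the two typed hypotheses is used; at `j = 1728` T9 says nothing meaningful (junk selector) and the
`LocIrr` form stands alone. [folklore] -/
theorem growthDichotomy_locIrr_of_growthDichotomyLaw (h9 : GrowthDichotomyLawThree)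
    (hsel : SelectorIdentityTameThree)
    (W : WeierstrassCurve ℚ) [W.IsElliptic] [W.IsGloballyMinimal] [NeZero (W.conductorNorm ℤ)]
    (f : CuspForm (Gamma0 (W.conductorNorm ℤ)) 2) (hf : IsNewformOf W f) (hO : ClassO5 W 3)
    (hT : SubTprime W 3) (hρ : W.HasIrreducibleModPGaloisRep 3) (hj0 : W.j ≠ 0) (hj : W.j ≠ 1728) :
    ∃ n₀ c₀ c₁ : ℕ, (¬ LocIrr W 3 → c₀ = c₁) ∧
      ∀ (n k : ℕ) (Θ : IwasawaAlgebra 3), n₀ ≤ n → IsScaledMazurTateLift f n k Θ → Θ ≠ 0 →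
        lam Θ = (if padicValRat 3 W.Δ = 9 then 2 else 1) * 3 ^ (n - 1) +
          (if LocIrr W 3 then kuriharaQ (n - 1) else 0) +
          (if n % 2 = 0 then c₀ else c₁) := by
  obtain ⟨n₀, c₀, c₁, hc, hlaw⟩ := h9 W f hf hO hT hρ hj0
  have key : LocIrr W 3 ↔ 7 ≤ padicValRat 3 (W.j - 1728) := hsel W hO hT hj
  refine ⟨n₀, c₀, c₁, fun hnL ↦ hc (not_le.mp fun h7 ↦ hnL (key.mpr h7)), ?_⟩
  intro n k Θ hn hΘ hΘ0
  have hl := hlaw n k Θ hn hΘ hΘ0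
  by_cases hL : LocIrr W 3
  · rw [if_pos hL]; rwa [if_pos (key.mp hL)] at hl
  · rw [if_neg hL]; rwa [if_neg (fun h7 ↦ hL (key.mpr h7))] at hl

/-- **CONVERSE BRIDGE (proved): the `LocIrr` form + the selector identity ⇒ T9's conclusion on
`j ≠ 1728`.** With `growthDichotomy_locIrr_of_growthDichotomyLaw` this makes the two formulations
EQUIVALENT on `j ≠ 1728` granted `SelectorIdentityTameThree`; at `j = 1728` (`c₆ = 0`: CM by `ℤ[i]`,
`LocIrr` holds by `locIrr_three_of_c₆_eq_zero` granted L-O56-sel) only the `LocIrr` form speaks (T9's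
selector `v₃(j − 1728)` is junk `0` there). Hence, with o5-r1's consent (GEN 3, 2026-08-21T10:27Z), the
NODE OF RECORD for the growth dichotomy is `GrowthDichotomyLawLocIrrThree` and T9
`O5.GrowthDichotomyLawThree` is RETIRED to a corollary-on-`j ≠ 1728` (its declaration kept verbatim in
`O5/O5GrowthLaws.lean`, `@[conjecture]` dropped — the T10 tombstone idiom). [folklore] -/
theorem growthDichotomyLaw_conclusion_of_locIrr (hL : GrowthDichotomyLawLocIrrThree)
    (hsel : SelectorIdentityTameThree)
    (W : WeierstrassCurve ℚ) [W.IsElliptic] [W.IsGloballyMinimal] [NeZero (W.conductorNorm ℤ)]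
    (f : CuspForm (Gamma0 (W.conductorNorm ℤ)) 2) (hf : IsNewformOf W f) (hO : ClassO5 W 3)
    (hT : SubTprime W 3) (hρ : W.HasIrreducibleModPGaloisRep 3) (hj0 : W.j ≠ 0) (hj : W.j ≠ 1728) :
    ∃ n₀ c₀ c₁ : ℕ, (padicValRat 3 (W.j - 1728) < 7 → c₀ = c₁) ∧
      ∀ (n k : ℕ) (Θ : IwasawaAlgebra 3), n₀ ≤ n → IsScaledMazurTateLift f n k Θ → Θ ≠ 0 →
        lam Θ = (if padicValRat 3 W.Δ = 9 then 2 else 1) * 3 ^ (n - 1) +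
          (if 7 ≤ padicValRat 3 (W.j - 1728) then kuriharaQ (n - 1) else 0) +
          (if n % 2 = 0 then c₀ else c₁) := by
  obtain ⟨n₀, c₀, c₁, hc, hlaw⟩ := hL W f hf hO hT hρ hj0
  have key : LocIrr W 3 ↔ 7 ≤ padicValRat 3 (W.j - 1728) := hsel W hO hT hj
  refine ⟨n₀, c₀, c₁, fun hlt ↦ hc (fun hLi ↦ absurd (key.mp hLi) (not_le.mpr hlt)), ?_⟩
  intro n k Θ hn hΘ hΘ0
  have hl := hlaw n k Θ hn hΘ hΘ0
  by_cases h7 : 7 ≤ padicValRat 3 (W.j - 1728)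
  · rw [if_pos h7]; rwa [if_pos (key.mpr h7)] at hl
  · rw [if_neg h7]; rwa [if_neg (fun hLi ↦ h7 (key.mp hLi))] at hl

/-- **T9's statement on `j ≠ 1728` as a COROLLARY of the node of record** (`GrowthDichotomyLawLocIrrThree`
+ `SelectorIdentityTameThree`): the retired j-form, minus its junk corner. [folklore] -/
theorem growthDichotomyLawThree_of_ne_1728 (hL : GrowthDichotomyLawLocIrrThree)
    (hsel : SelectorIdentityTameThree) :
    ∀ (W : WeierstrassCurve ℚ) [W.IsElliptic] [W.IsGloballyMinimal] [NeZero (W.conductorNorm ℤ)]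
      (f : CuspForm (Gamma0 (W.conductorNorm ℤ)) 2), IsNewformOf W f → ClassO5 W 3 → SubTprime W 3 →
      W.HasIrreducibleModPGaloisRep 3 → W.j ≠ 0 → W.j ≠ 1728 →
      ∃ n₀ c₀ c₁ : ℕ, (padicValRat 3 (W.j - 1728) < 7 → c₀ = c₁) ∧
        ∀ (n k : ℕ) (Θ : IwasawaAlgebra 3), n₀ ≤ n → IsScaledMazurTateLift f n k Θ → Θ ≠ 0 →
          lam Θ = (if padicValRat 3 W.Δ = 9 then 2 else 1) * 3 ^ (n - 1) +
            (if 7 ≤ padicValRat 3 (W.j - 1728) then kuriharaQ (n - 1) else 0) +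
            (if n % 2 = 0 then c₀ else c₁) :=
  fun W _ _ _ f hf hO hT hρ hj0 hj ↦
    growthDichotomyLaw_conclusion_of_locIrr hL hsel W f hf hO hT hρ hj0 hj

/-- On a type-III* O5b curve (`v₃Δ = 9`) the `LocIrr` form's signed template IS `Additive.signedBase 9`
and on type III (`v₃Δ = 3`) it is `signedBase 3` — the TEMPLATE IDENTITY (o6-r1 (G3-10): IV*-irr =
III*-near, II-irr = III-near) as a definitional equation, for `n ≥ 1`. [folklore] -/
theorem signedTemplate_eq_signedBase (n : ℕ) :
    2 * 3 ^ (n - 1) + kuriharaQ (n - 1) = Additive.signedBase 9 n ∧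
      1 * 3 ^ (n - 1) + kuriharaQ (n - 1) = Additive.signedBase 3 n := by
  simp [Additive.signedBase]

end Summit.BirchSwinnertonDyer.Rank1Residual.O5

/-! ## §5 The joint EVIDENCE declaration T-O6-D (o6-r1 ⟦07:25Z⟧; cross-cell with o5-r1) -/

namespace Summit.BirchSwinnertonDyer.Rank1Residual.Additive

section Joint

variable (real : ∀ (W : WeierstrassCurve ℚ) [W.IsElliptic] [W.IsGloballyMinimal],
  O6.TowerValuation W → Prop)
variable (realLevel : ∀ (W : WeierstrassCurve ℚ) [W.IsElliptic] [W.IsGloballyMinimal],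
  O6.IsogenyLevelDatum W → Prop)

/-- **T-O6-D ≡ `MazurTateGrowthDichotomyThree` (EVIDENCE conjecture; o6-r1 GEN 3's seat instrument,
CONVERGED §O6 addendum ⟦07:25Z⟧, proposed cross-cell to o5-r1): for `W` additive at `3` with potentially
supersingular reduction, `λ(θ_k(W))` follows the SIGNED Kurihara–Pollack template iff `W[3]|G_{ℚ₃}` is
irreducible and the UNSIGNED level template iff it is reducible — tame (`e = 4`, O5b: clause
`O5.GrowthDichotomyLawLocIrrThree` = o5-r1's T9 re-keyed) and wild (`f₃ ∈ {3,5}`, O6-dicyclic: clauses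
D-R `DicyclicLevelLawThree` and S1–S4 `SignedPollackShapeThree`) alike.** A CONJUNCTION of the typed
clauses (asserting nothing new); O5a (`e = 2`, all `LocIrr`, signed by Lei–Pollack–Pratap Thm 4.5 — in
print) and O6-cyclic (all reducible by `LocIrrThreeTameCube`/census 0/5 161; unsigned law v3′ pending
band C1′) are the two cells where the dichotomy is one-sided. Offered as the answer to Doyon–Lei §6's
question; = the POLLACK–WESTON SHAPE (Thm 1: reducible ↦ unsigned, irreducible ↦ signed, at `p ∤ N`)
transplanted to additive level `9 ∣ N` (EVIDENCE: 184/184 literature set + 31 044 + 108 + 188 + 2 724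
rows; nothing in print there). [cite: DoyonLei2021, §6] [cite: LeiPollackPratap2024, Thm 2, Thm 4.5, §4.3]
[cite: Pollack2003, Prop. 6.9–6.10] [cite: PollackWeston2011MT, Thm. 1 = Cor. 5.3] -/
@[conjecture] def MazurTateGrowthDichotomyThree : Prop :=
  O5.GrowthDichotomyLawLocIrrThree ∧ DicyclicLevelLawThree real realLevel ∧ SignedPollackShapeThree real

/-- The joint declaration projects to its O5b clause. [folklore] -/
theorem MazurTateGrowthDichotomyThree.tame (h : MazurTateGrowthDichotomyThree real realLevel) :
    O5.GrowthDichotomyLawLocIrrThree := h.1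

/-- … and to the dicyclic reducible level law. [folklore] -/
theorem MazurTateGrowthDichotomyThree.dicyclicLevel (h : MazurTateGrowthDichotomyThree real realLevel) :
    DicyclicLevelLawThree real realLevel := h.2.1

/-- … and to the signed shape. [folklore] -/
theorem MazurTateGrowthDichotomyThree.signed (h : MazurTateGrowthDichotomyThree real realLevel) :
    SignedPollackShapeThree real := h.2.2

end Joint

end Summit.BirchSwinnertonDyer.Rank1Residual.Additive

end
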